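import Summits.NavierStokesRegularity.FluidComputer.BlockQuadDrift

/-!
# Block design — the two-mode PAIR FIELD: stall sector, transfer ceiling, VISCOUS CEILING
(bp3 gen 36, ASSEMBLY §2g.9(s); tools for the (β″₁) question of R1-DESIGN §24.15(3))

HONEST FRAMING: low prior, high value-of-information experiment on Tao's machine paradigm; NOT a
claim that NS blows up. Design level only: nothing in this file is a statement about
Navier–Stokes; it is elementary real analysis of one planar polynomial vector field.

`BlockReachRigidity` / `BlockReachLoading` (ASKs 98, 99) computed the field that an inhabited
instantaneous residue PINS the design to on the clean two-mode states: the two-mode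
Galerkin–Navier–Stokes field of the wavelet pair `(ψ_n, ψ_{n+1})`, which in readout coordinates
`(a, b)` and rescaled time is of the form

  `pairVF Λ₁ Λ₂ η k k' (a, b) = (-Λ₁ a - η k a b + η k' b², -Λ₂ b + k a² - k' a b)`

(`Λ₁, Λ₂ ≥ 0` the rescaled viscous rates of the two blocks, `η = E_{n+1}/E_n`, `k ∝ κ_n` the
FORWARD triad coefficient `Re⟨B(ψ_n,ψ_n),ψ_{n+1}⟩`, `k' ∝ κ'_n` the BACKSCATTER coefficient
`Re⟨B(ψ_{n+1},ψ_{n+1}),ψ_n⟩`; the identification is `BlockPairCeiling.smul_nsVF_eq_pairVF`).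
The lane's quadratic gate `quadVF k η` is the member `Λ₁ = Λ₂ = k' = 0` (`pairVF_quad`).

SCOPE (honest). For the lane's wavelet class `CascadeWaveletData 1 m` the backscatter
coefficient VANISHES IDENTICALLY, `κ'_n = 0`, by frequency bookkeeping (`BlockPairSupport`,
`eulerForm_mode_succ_succ_self`): the pinned field of every admissible design is the VISCOUSLY
DAMPED GATE `pairVF Λ₁ Λ₂ η k 0`, and the theorems below are used at `k' = 0`. They are stated
for a general `k' ≥ 0` because the analysis is the same and covers two-mode Galerkin pairs with
other frequency localisations; the backscatter clauses (`pair_stall`, the `k'`-part of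
`pair_ceiling`, `pair_snd_lt_of_backscatter`) carry NO information for the lane's class.

THE THEOREMS (exact orbits from a clean input `(A₀, 0)`, `A₀ > 0`, with `k > 0`, `k' ≥ 0`,
`η ≥ 0`, on any `[0, T]`):
* `pair_fst_pos` — the input amplitude never vanishes (`a > 0`): no complete transfer in
  finite time; `pair_energy_le` — `a² + η b² ≤ A₀²` (`Λ₁, Λ₂ ≥ 0`); `pair_snd_nonneg` — `b ≥ 0`;
* `pair_snd_le_viscous` — the VISCOUS CEILING `b(t) ≤ (k A₀²/Λ₂)(1 - e^{-Λ₂ t})` (`Λ₂ > 0`):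
  the receiving mode is driven by at most `k a² ≤ k A₀²` against its own dissipation `Λ₂ b`;
  `pair_snd_lt_of_subcritical` — if `k A₀ ≤ Λ₂` the output amplitude NEVER reaches `A₀`;
* (general `k'`) `pair_stall` — the orbit stays in the STALL SECTOR `k' b ≤ k a` (`Λ₁ ≤ Λ₂`;
  the exchange part vanishes on the line `k a = k' b`, `pairVF_stall_line`); `pair_ceiling` —
  `b² (k'² + η k²) ≤ k² A₀²`; `pair_snd_lt_of_backscatter` — `k'² > (1-η) k²` ⇒ `b < A₀`.

CONSEQUENCE (drawn in `BlockPairCeiling`). The hand-off of the block architecture needs output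
amplitude `≥ aLo` from the clean admissible input `(aLo, 0)` within one tick; along the pinned
field this requires the block to be SUPERCRITICAL, `k aLo > Λ₂`, i.e. in wavelet terms
`E_n κ_n aLo > √E_{n+1} Λ_{n+1}` — a necessary condition on the spec sheet and the wavelet
(a Reynolds-number threshold), below which no reach certificate on any open working region can
coexist with an inhabited residue. Necessary, far from sufficient; no selection rule on the
wavelet pair follows from backscatter (there is none in this class).
[cite: Tao2016AveragedNS, §1.3 pp. 10–11]
-/

open Set Filter Topology

namespace Summit.NavierStokesRegularity.FluidComputer

open Literature.Analysis.FluidPDE Literature.Analysis.FluidPDE.FluidComputer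

namespace BlockDesign

/-! ## The pair field and its pointwise structure -/

/-- The TWO-MODE PAIR FIELD in readout coordinates and rescaled time:
`pairVF Λ₁ Λ₂ η k k' (a, b) = (-Λ₁ a - η k a b + η k' b², -Λ₂ b + k a² - k' a b)` — viscous damping
`Λ₁, Λ₂`, forward exchange `k`, backscatter `k'`, energy ratio `η`. [folklore] -/
def pairVF (Λ₁ Λ₂ η k k' : ℝ) (z : ℝ × ℝ) : ℝ × ℝ :=
  (-(Λ₁ * z.1) - η * k * z.1 * z.2 + η * k' * z.2 ^ 2,
    -(Λ₂ * z.2) + k * z.1 ^ 2 - k' * z.1 * z.2)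

/-- The lane's quadratic gate is the inviscid, backscatter-free member: `pairVF 0 0 η k 0 = quadVF
k η`. [folklore] -/
theorem pairVF_quad (η k : ℝ) : pairVF 0 0 η k 0 = quadVF k η := by
  funext z
  simp only [pairVF, quadVF, Prod.mk.injEq]
  constructor <;> ring

/-- ENERGY IDENTITY: `2 (a V₁ + η b V₂) = -2 (Λ₁ a² + η Λ₂ b²)` — the exchange terms are tangent to
the energy ellipses, only viscosity moves the energy. [folklore] -/
theorem pairVF_energy (Λ₁ Λ₂ η k k' : ℝ) (z : ℝ × ℝ) :
    2 * (z.1 * (pairVF Λ₁ Λ₂ η k k' z).1 + η * z.2 * (pairVF Λ₁ Λ₂ η k k' z).2) =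
      -(2 * (Λ₁ * z.1 ^ 2 + η * Λ₂ * z.2 ^ 2)) := by
  simp only [pairVF]; ring

/-- ANGULAR IDENTITY: `V₂ a - b V₁ = -(Λ₂ - Λ₁) a b + (k a - k' b)(a² + η b²)` — the numerator
of the slope equation. [folklore] -/
theorem pairVF_cross (Λ₁ Λ₂ η k k' : ℝ) (z : ℝ × ℝ) :
    (pairVF Λ₁ Λ₂ η k k' z).2 * z.1 - z.2 * (pairVF Λ₁ Λ₂ η k k' z).1 =
      -((Λ₂ - Λ₁) * z.1 * z.2) + (k * z.1 - k' * z.2) * (z.1 ^ 2 + η * z.2 ^ 2) := by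
  simp only [pairVF]; ring

/-- THE STALL LINE: the inviscid pair field vanishes identically on `k a = k' b` — a line of
equilibria of the conservative exchange. [folklore] -/
theorem pairVF_stall_line (η k k' : ℝ) {z : ℝ × ℝ} (h : k * z.1 = k' * z.2) :
    pairVF 0 0 η k k' z = 0 := by
  have h1 : (pairVF 0 0 η k k' z).1 = -(η * z.2 * (k * z.1 - k' * z.2)) := by
    simp only [pairVF]; ring
  have h2 : (pairVF 0 0 η k k' z).2 = z.1 * (k * z.1 - k' * z.2) := by
    simp only [pairVF]; ring
  ext
  · rw [h1, h, sub_self, mul_zero, neg_zero, Prod.fst_zero]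
  · rw [h2, h, sub_self, mul_zero, Prod.snd_zero]

/-- Input component from below: `V₁ ≥ -(Λ₁ + η k b) a` (the backscatter term `η k' b²` is
nonnegative). [folklore] -/
theorem pairVF_fst_ge {Λ₁ Λ₂ η k k' : ℝ} (hη : 0 ≤ η) (hk' : 0 ≤ k') (z : ℝ × ℝ) :
    -((Λ₁ + η * k * z.2) * z.1) ≤ (pairVF Λ₁ Λ₂ η k k' z).1 := by
  simp only [pairVF]
  nlinarith [mul_nonneg (mul_nonneg hη hk') (sq_nonneg z.2)]

/-! ## Exact orbits from a clean input stay in the stall sector -/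

section Orbit

variable {Λ₁ Λ₂ η k k' T : ℝ} {z : ℝ → ℝ × ℝ}

/-- **NO COMPLETE TRANSFER.** Along an exact orbit of the pair field (`η ≥ 0`, `k' ≥ 0`) on `[0, T]`
with `a(0) > 0`, the input amplitude stays positive: `a(t) > 0` (exponential lower fence
`a ≥ (a(0)/2) e^{-βt}`, `β = Λ₁ + η k sup|b| + 1`, from `a' ≥ -(Λ₁ + η k b) a`). [folklore] -/
theorem pair_fst_pos (hη : 0 ≤ η) (hk : 0 ≤ k) (hk' : 0 ≤ k')
    (hcont : ContinuousOn z (Icc 0 T))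
    (hderiv : ∀ t ∈ Ico 0 T, HasDerivWithinAt z (pairVF Λ₁ Λ₂ η k k' (z t)) (Ici t) t)
    (h0 : 0 < (z 0).1) : ∀ t ∈ Icc 0 T, 0 < (z t).1 := by
  obtain ⟨C, hC⟩ := isCompact_Icc.exists_bound_of_continuousOn hcont
  set A₀ : ℝ := (z 0).1 with hA₀
  set β : ℝ := |Λ₁| + η * k * C + 1 with hβ
  set Bd : ℝ → ℝ := fun x => -(A₀ / 2) * Real.exp (-β * x) with hBd
  have hBd' : ∀ x, HasDerivAt Bd (β * (A₀ / 2 * Real.exp (-β * x))) x := fun x => by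
    have h := (((hasDerivAt_id x).const_mul (-β)).exp).const_mul (-(A₀ / 2))
    refine h.congr_deriv ?_
    simp only [id, mul_one]; ring
  have hf : ContinuousOn (fun x => -(z x).1) (Icc 0 T) := hcont.fst.neg
  have hf' : ∀ x ∈ Ico 0 T,
      HasDerivWithinAt (fun x => -(z x).1) (-(pairVF Λ₁ Λ₂ η k k' (z x)).1) (Ici x) x :=
    fun x hx => (hasDerivWithinAt_fst_comp (hderiv x hx)).neg
  have key := image_le_of_deriv_right_lt_deriv_boundary hf hf' (B := Bd)
    (B' := fun x => β * (A₀ / 2 * Real.exp (-β * x)))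
    (by
      show -(z 0).1 ≤ -(A₀ / 2) * Real.exp (-β * 0)
      rw [mul_zero, Real.exp_zero, mul_one]; linarith) hBd'
    (fun x hx hfx => by
      -- at the fence: `a = (A₀/2) e^{-βx} > 0`
      have ha : (z x).1 = A₀ / 2 * Real.exp (-β * x) := by
        simp only [hBd] at hfx; linarith
      have hapos : 0 < (z x).1 := by rw [ha]; positivity
      have hb : |(z x).2| ≤ C := (norm_snd_le (z x)).trans (hC x (Ico_subset_Icc_self hx))
      have h1 := pairVF_fst_ge (Λ₁ := Λ₁) (Λ₂ := Λ₂) (k := k) hη hk' (z x)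
      have h2 : (Λ₁ + η * k * (z x).2) * (z x).1 < β * (z x).1 := by
        apply mul_lt_mul_of_pos_right _ hapos
        have h3 : η * k * (z x).2 ≤ η * k * C :=
          mul_le_mul_of_nonneg_left ((le_abs_self _).trans hb) (mul_nonneg hη hk)
        simp only [hβ]; linarith [le_abs_self Λ₁]
      rw [← ha]; linarith)
  intro t ht
  have h := key ht
  have hpos : 0 < A₀ / 2 * Real.exp (-β * t) := by positivity
  simp only [hBd] at h
  linarith

/-- **ENERGY BOUND**: `a(t)² + η b(t)² ≤ a(0)² + η b(0)²` (`Λ₁, Λ₂, η ≥ 0`). [folklore] -/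
theorem pair_energy_le (hΛ₁ : 0 ≤ Λ₁) (hΛ₂ : 0 ≤ Λ₂) (hη : 0 ≤ η)
    (hcont : ContinuousOn z (Icc 0 T))
    (hderiv : ∀ t ∈ Ico 0 T, HasDerivWithinAt z (pairVF Λ₁ Λ₂ η k k' (z t)) (Ici t) t) :
    ∀ t ∈ Icc 0 T, pairEnergy η (z t) ≤ pairEnergy η (z 0) := by
  have hf := continuousOn_pairEnergy_comp hcont η
  have hf' := fun x (hx : x ∈ Ico 0 T) => hasDerivWithinAt_pairEnergy_comp (hderiv x hx) η
  intro t ht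
  exact image_le_of_deriv_right_le_deriv_boundary hf hf' (B := fun _ => pairEnergy η (z 0))
    (B' := fun _ => 0) le_rfl (fun _ _ => continuousWithinAt_const)
    (fun _ _ => hasDerivWithinAt_const _ _ _)
    (fun x _ => by
      rw [pairVF_energy]
      nlinarith [mul_nonneg hΛ₁ (sq_nonneg (z x).1),
        mul_nonneg (mul_nonneg hη hΛ₂) (sq_nonneg (z x).2)]) ht

/-- The slope `w = b/a` along an orbit with `a > 0`: right derivative
`(V₂ a - b V₁)/a²`. [folklore] -/
theorem pair_hasDerivWithinAt_slope
    (hderiv : ∀ t ∈ Ico 0 T, HasDerivWithinAt z (pairVF Λ₁ Λ₂ η k k' (z t)) (Ici t) t)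
    (hpos : ∀ t ∈ Icc 0 T, 0 < (z t).1) :
    ∀ x ∈ Ico 0 T, HasDerivWithinAt (fun t => (z t).2 / (z t).1)
      (((pairVF Λ₁ Λ₂ η k k' (z x)).2 * (z x).1 - (z x).2 * (pairVF Λ₁ Λ₂ η k k' (z x)).1) /
        (z x).1 ^ 2) (Ici x) x :=
  fun x hx => (hasDerivWithinAt_snd_comp (hderiv x hx)).div
    (hasDerivWithinAt_fst_comp (hderiv x hx)) (hpos x (Ico_subset_Icc_self hx)).ne'

/-- **LOWER EDGE OF THE STALL SECTOR**: `b(t) ≥ 0` from a clean input `(A₀, 0)`, `A₀ > 0`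
(`k > 0`, `k' ≥ 0`, `η ≥ 0`): `a > 0` throughout (`pair_fst_pos`), and the slope `w = b/a` is
fenced at `0` from below, since `w = 0` forces `w' = k a > 0` (`pairVF_cross`). [folklore] -/
theorem pair_snd_nonneg (hη : 0 ≤ η) (hk : 0 < k) (hk' : 0 ≤ k')
    (hcont : ContinuousOn z (Icc 0 T))
    (hderiv : ∀ t ∈ Ico 0 T, HasDerivWithinAt z (pairVF Λ₁ Λ₂ η k k' (z t)) (Ici t) t)
    (h0 : 0 < (z 0).1) (h0' : (z 0).2 = 0) : ∀ t ∈ Icc 0 T, 0 ≤ (z t).2 := by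
  have hpos := pair_fst_pos hη hk.le hk' hcont hderiv h0
  have hw := pair_hasDerivWithinAt_slope hderiv hpos
  have hwc : ContinuousOn (fun t => (z t).2 / (z t).1) (Icc 0 T) :=
    hcont.snd.div hcont.fst fun t ht => (hpos t ht).ne'
  have key := image_le_of_deriv_right_lt_deriv_boundary (f := fun t => -((z t).2 / (z t).1))
    hwc.neg (fun x hx => (hw x hx).neg) (B := fun _ => 0) (B' := fun _ => 0)
    (by simp [h0']) (fun _ => hasDerivAt_const _ _)
    (fun x hx hfx => by
      have ha := hpos x (Ico_subset_Icc_self hx)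
      have hb : (z x).2 = 0 := by
        have : (z x).2 / (z x).1 = 0 := by linarith
        simpa [ha.ne'] using this
      rw [pairVF_cross, hb]
      have h3 : 0 < k * (z x).1 * ((z x).1 ^ 2) / (z x).1 ^ 2 := by positivity
      have h4 : -((Λ₂ - Λ₁) * (z x).1 * 0) + (k * (z x).1 - k' * 0) * ((z x).1 ^ 2 + η * 0 ^ 2)
          = k * (z x).1 * (z x).1 ^ 2 := by ring
      rw [h4]; linarith)
  intro t ht
  have h : -((z t).2 / (z t).1) ≤ 0 := key ht
  have ha := hpos t ht
  have h' : 0 ≤ (z t).2 / (z t).1 * (z t).1 := mul_nonneg (by linarith) ha.le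
  rwa [div_mul_cancel₀ _ ha.ne'] at h'

/-- **UPPER EDGE OF THE STALL SECTOR (the backscatter stall)**: `k' b(t) ≤ k a(t)` from a clean
input (`k > 0`, `k' ≥ 0`, `Λ₁ ≤ Λ₂`, `η ≥ 0`): for `k' > 0` the slope `w = b/a` is fenced from
above at every level `k/k' + δ`, `δ > 0`, where `w' = -(Λ₂-Λ₁) w - k' δ a (1 + η w²) < 0`; then
`δ → 0`. (`k' = 0` is trivial since `a > 0`.) [folklore] -/
theorem pair_stall (hΛ : Λ₁ ≤ Λ₂) (hη : 0 ≤ η) (hk : 0 < k) (hk' : 0 ≤ k')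
    (hcont : ContinuousOn z (Icc 0 T))
    (hderiv : ∀ t ∈ Ico 0 T, HasDerivWithinAt z (pairVF Λ₁ Λ₂ η k k' (z t)) (Ici t) t)
    (h0 : 0 < (z 0).1) (h0' : (z 0).2 = 0) : ∀ t ∈ Icc 0 T, k' * (z t).2 ≤ k * (z t).1 := by
  have hpos := pair_fst_pos hη hk.le hk' hcont hderiv h0
  rcases hk'.eq_or_lt with hk0 | hk'0
  · intro t ht
    rw [← hk0, zero_mul]
    exact (mul_pos hk (hpos t ht)).le
  have hw := pair_hasDerivWithinAt_slope hderiv hpos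
  have hwc : ContinuousOn (fun t => (z t).2 / (z t).1) (Icc 0 T) :=
    hcont.snd.div hcont.fst fun t ht => (hpos t ht).ne'
  have hb0 := pair_snd_nonneg hη hk hk' hcont hderiv h0 h0'
  -- fence at every level `k/k' + δ`
  have hle : ∀ δ : ℝ, 0 < δ → ∀ t ∈ Icc 0 T, (z t).2 / (z t).1 ≤ k / k' + δ := by
    intro δ hδ t ht
    refine image_le_of_deriv_right_lt_deriv_boundary hwc hw (B := fun _ => k / k' + δ)
      (B' := fun _ => 0) ?_ (fun _ => hasDerivAt_const _ _) (fun x hx hfx => ?_) ht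
    · have : (0 : ℝ) ≤ k / k' + δ := by positivity
      simpa [h0'] using this
    · have ha := hpos x (Ico_subset_Icc_self hx)
      have hk'ne : k' ≠ 0 := hk'0.ne'
      have hb : (z x).2 = (k / k' + δ) * (z x).1 := (div_eq_iff ha.ne').1 hfx
      have hgap : k * (z x).1 - k' * (z x).2 = -(k' * δ * (z x).1) := by
        rw [hb]; field_simp; ring
      have hbx : 0 ≤ (z x).2 := hb0 x (Ico_subset_Icc_self hx)
      rw [pairVF_cross, hgap]
      apply div_neg_of_neg_of_pos _ (by positivity)
      have h1 : 0 ≤ (Λ₂ - Λ₁) * (z x).1 * (z x).2 := by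
        have := sub_nonneg.2 hΛ; positivity
      have h2 : 0 < k' * δ * (z x).1 * ((z x).1 ^ 2 + η * (z x).2 ^ 2) := by positivity
      nlinarith
  intro t ht
  have ha := hpos t ht
  have hwle : (z t).2 / (z t).1 ≤ k / k' :=
    le_of_forall_gt_imp_ge_of_dense fun c hc => by
      have := hle (c - k / k') (sub_pos.2 hc) t ht
      linarith
  have h1 : (z t).2 ≤ k / k' * (z t).1 := (div_le_iff₀ ha).1 hwle
  have h2 : k' * (k / k') = k := by field_simp
  calc k' * (z t).2 ≤ k' * (k / k' * (z t).1) := mul_le_mul_of_nonneg_left h1 hk'0.le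
    _ = k * (z t).1 := by rw [← mul_assoc, h2]

/-- **THE TRANSFER CEILING.** From a clean input `(A₀, 0)`, `A₀ > 0` (`k > 0`, `k' ≥ 0`,
`0 ≤ Λ₁ ≤ Λ₂`, `η ≥ 0`): `b(t)² (k'² + η k²) ≤ k² A₀²` for all `t ∈ [0, T]`, i.e. the output
amplitude never exceeds `A₀ k/√(k'² + η k²)` (stall sector + energy bound). [folklore] -/
theorem pair_ceiling (hΛ₁ : 0 ≤ Λ₁) (hΛ : Λ₁ ≤ Λ₂) (hη : 0 ≤ η) (hk : 0 < k) (hk' : 0 ≤ k')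
    (hcont : ContinuousOn z (Icc 0 T))
    (hderiv : ∀ t ∈ Ico 0 T, HasDerivWithinAt z (pairVF Λ₁ Λ₂ η k k' (z t)) (Ici t) t)
    (h0 : 0 < (z 0).1) (h0' : (z 0).2 = 0) :
    ∀ t ∈ Icc 0 T, (z t).2 ^ 2 * (k' ^ 2 + η * k ^ 2) ≤ k ^ 2 * (z 0).1 ^ 2 := by
  intro t ht
  have hE := pair_energy_le hΛ₁ (hΛ₁.trans hΛ) hη hcont hderiv t ht
  have hs := pair_stall hΛ hη hk hk' hcont hderiv h0 h0' t ht
  have hb := pair_snd_nonneg hη hk hk' hcont hderiv h0 h0' t ht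
  simp only [pairEnergy, h0'] at hE
  have h1 : (k' * (z t).2) ^ 2 ≤ (k * (z t).1) ^ 2 :=
    pow_le_pow_left₀ (mul_nonneg hk' hb) hs 2
  nlinarith [h1, hE, sq_nonneg k]

/-- **BACKSCATTER DOMINANCE FORBIDS THE HAND-OFF AMPLITUDE**: if `k'² > (1 - η) k²`, the output
amplitude from the clean input `(A₀, 0)` stays STRICTLY below `A₀` for all times. [folklore] -/
theorem pair_snd_lt_of_backscatter (hΛ₁ : 0 ≤ Λ₁) (hΛ : Λ₁ ≤ Λ₂) (hη : 0 ≤ η) (hk : 0 < k)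
    (hk' : 0 ≤ k') (hgap : (1 - η) * k ^ 2 < k' ^ 2)
    (hcont : ContinuousOn z (Icc 0 T))
    (hderiv : ∀ t ∈ Ico 0 T, HasDerivWithinAt z (pairVF Λ₁ Λ₂ η k k' (z t)) (Ici t) t)
    (h0 : 0 < (z 0).1) (h0' : (z 0).2 = 0) : ∀ t ∈ Icc 0 T, (z t).2 < (z 0).1 := by
  intro t ht
  have hc := pair_ceiling hΛ₁ hΛ hη hk hk' hcont hderiv h0 h0' t ht
  have hb := pair_snd_nonneg hη hk hk' hcont hderiv h0 h0' t ht
  by_contra hge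
  have hge := not_lt.1 hge
  have h1 : (z 0).1 ^ 2 ≤ (z t).2 ^ 2 := pow_le_pow_left₀ h0.le hge 2
  have h2 : k ^ 2 < k' ^ 2 + η * k ^ 2 := by linarith
  nlinarith [mul_le_mul_of_nonneg_left h1 (by positivity : (0:ℝ) ≤ k' ^ 2 + η * k ^ 2),
    mul_lt_mul_of_pos_right h2 (pow_pos h0 2)]

/-- **THE VISCOUS CEILING.** From a clean input `(A₀, 0)`, `A₀ > 0` (`k > 0`, `k' ≥ 0`,
`Λ₁ ≥ 0`, `Λ₂ > 0`, `η ≥ 0`): `b(t) ≤ (k A₀²/Λ₂)(1 - e^{-Λ₂ t})` for all `t ∈ [0, T]` — the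
receiving mode is driven by at most `k a² ≤ k A₀²` (energy bound; the backscatter term
`-k' a b ≤ 0` only drains it) against its own dissipation `Λ₂ b` (boundary comparison for
`b e^{Λ₂ t}`). [folklore] -/
theorem pair_snd_le_viscous (hΛ₁ : 0 ≤ Λ₁) (hΛ₂ : 0 < Λ₂) (hη : 0 ≤ η) (hk : 0 < k)
    (hk' : 0 ≤ k') (hcont : ContinuousOn z (Icc 0 T))
    (hderiv : ∀ t ∈ Ico 0 T, HasDerivWithinAt z (pairVF Λ₁ Λ₂ η k k' (z t)) (Ici t) t)
    (h0 : 0 < (z 0).1) (h0' : (z 0).2 = 0) :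
    ∀ t ∈ Icc 0 T, (z t).2 ≤ k * (z 0).1 ^ 2 / Λ₂ * (1 - Real.exp (-Λ₂ * t)) := by
  have hpos := pair_fst_pos hη hk.le hk' hcont hderiv h0
  have hb := pair_snd_nonneg hη hk hk' hcont hderiv h0 h0'
  have hE := pair_energy_le hΛ₁ hΛ₂.le hη hcont hderiv
  set A₀ : ℝ := (z 0).1 with hA₀
  set Bd : ℝ → ℝ := fun x => k * A₀ ^ 2 / Λ₂ * (Real.exp (Λ₂ * x) - 1) with hBd
  have hBd' : ∀ x, HasDerivAt Bd (k * A₀ ^ 2 * Real.exp (Λ₂ * x)) x := fun x => by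
    have h := ((((hasDerivAt_id x).const_mul Λ₂).exp).sub_const 1).const_mul (k * A₀ ^ 2 / Λ₂)
    refine h.congr_deriv ?_
    simp only [id, mul_one]
    field_simp
  have hex' : ∀ x, HasDerivAt (fun y => Real.exp (Λ₂ * y)) (Λ₂ * Real.exp (Λ₂ * x)) x :=
    fun x => by
    have h := ((hasDerivAt_id x).const_mul Λ₂).exp
    refine h.congr_deriv ?_
    simp only [id, mul_one, mul_comm]
  have hf : ContinuousOn (fun x => (z x).2 * Real.exp (Λ₂ * x)) (Icc 0 T) :=
    hcont.snd.mul fun x _ => (hex' x).continuousAt.continuousWithinAt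
  have hf' : ∀ x ∈ Ico 0 T, HasDerivWithinAt (fun x => (z x).2 * Real.exp (Λ₂ * x))
      ((pairVF Λ₁ Λ₂ η k k' (z x)).2 * Real.exp (Λ₂ * x) +
        (z x).2 * (Λ₂ * Real.exp (Λ₂ * x))) (Ici x) x :=
    fun x hx => (hasDerivWithinAt_snd_comp (hderiv x hx)).mul (hex' x).hasDerivWithinAt
  have key := image_le_of_deriv_right_le_deriv_boundary hf hf' (B := Bd)
    (B' := fun x => k * A₀ ^ 2 * Real.exp (Λ₂ * x))
    (by simp [hBd, h0'])
    (fun x _ => (hBd' x).continuousAt.continuousWithinAt)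
    (fun x _ => (hBd' x).hasDerivWithinAt)
    (fun x hx => by
      have hxI := Ico_subset_Icc_self hx
      have ha := hpos x hxI
      have hbx := hb x hxI
      have hEx := hE x hxI
      simp only [pairEnergy, h0'] at hEx
      have hex : 0 < Real.exp (Λ₂ * x) := Real.exp_pos _
      have h1 : (z x).1 ^ 2 ≤ A₀ ^ 2 := by nlinarith [mul_nonneg hη (sq_nonneg (z x).2)]
      have hV : (pairVF Λ₁ Λ₂ η k k' (z x)).2 + Λ₂ * (z x).2 ≤ k * A₀ ^ 2 := by
        simp only [pairVF]
        nlinarith [mul_nonneg (mul_nonneg hk' ha.le) hbx, mul_le_mul_of_nonneg_left h1 hk.le]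
      nlinarith [mul_le_mul_of_nonneg_right hV hex.le])
  intro t ht
  have h := key ht
  have hex : 0 < Real.exp (Λ₂ * t) := Real.exp_pos _
  have hneg : Real.exp (-Λ₂ * t) = (Real.exp (Λ₂ * t))⁻¹ := by rw [neg_mul, Real.exp_neg]
  rw [hneg, show k * A₀ ^ 2 / Λ₂ * (1 - (Real.exp (Λ₂ * t))⁻¹) =
    (k * A₀ ^ 2 / Λ₂ * (Real.exp (Λ₂ * t) - 1)) / Real.exp (Λ₂ * t) by field_simp,
    le_div_iff₀ hex]
  simpa [hBd] using h

/-- **NO HAND-OFF AMPLITUDE BELOW THE VISCOUS THRESHOLD**: if `k A₀ ≤ Λ₂` (drive × input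
amplitude at most the dissipation rate of the receiving mode), the output amplitude from the
clean input `(A₀, 0)` stays STRICTLY below `A₀` for all `t ∈ [0, T]`. [folklore] -/
theorem pair_snd_lt_of_subcritical (hΛ₁ : 0 ≤ Λ₁) (hΛ₂ : 0 < Λ₂) (hη : 0 ≤ η) (hk : 0 < k)
    (hk' : 0 ≤ k') (hsub : k * (z 0).1 ≤ Λ₂) (hcont : ContinuousOn z (Icc 0 T))
    (hderiv : ∀ t ∈ Ico 0 T, HasDerivWithinAt z (pairVF Λ₁ Λ₂ η k k' (z t)) (Ici t) t)
    (h0 : 0 < (z 0).1) (h0' : (z 0).2 = 0) : ∀ t ∈ Icc 0 T, (z t).2 < (z 0).1 := by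
  intro t ht
  have h := pair_snd_le_viscous hΛ₁ hΛ₂ hη hk hk' hcont hderiv h0 h0' t ht
  have hex : 0 < Real.exp (-Λ₂ * t) := Real.exp_pos _
  have h1 : k * (z 0).1 ^ 2 / Λ₂ ≤ (z 0).1 := by
    rw [div_le_iff₀ hΛ₂]
    nlinarith [mul_le_mul_of_nonneg_left hsub h0.le]
  have hc : 0 < k * (z 0).1 ^ 2 / Λ₂ := by positivity
  nlinarith [mul_pos hc hex]

end Orbit

end BlockDesign

end Summit.NavierStokesRegularity.FluidComputer
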